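import Mathlib
import HarnessLib
import Summits.Ventures.LatticeQCDFlow.Scaling.PlaquettePeelingRank
import Summits.Ventures.LatticeQCDFlow.Scaling.AutoregressiveGaugeHeatBathExact2D

/-!
# LatticeQCDFlow / Scaling — heat-bath exactness on RANKED plaquette collections, in every dimension

HONEST FRAMING: exact (Metropolis-corrected) sampling algorithms for lattice gauge theory;
figures of merit are autocorrelation/cost numbers at stated couplings and volumes; no
continuum-physics claim.

Venture `LatticeQCDFlow` (cell pub-lqcd), topic `Scaling`, FANOUT row 30 (lean-1, GEN-24) — OUR WORK on
THEORY-2.md §4 row C5, the autoregressive (`arHybrid`) half of heat-bath exactness beyond rectangles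
that `Scaling/PlaquettePeelingRank` (GEN-23) left open.  `Scaling/AutoregressiveGaugeHeatBathExact2D`
proved, for a free-boundary RECTANGLE of `(ℤ/L)²`, that the autoregressive model whose conditioner at the
top link of a block plaquette `p` is the one-plaquette heat bath `w(U_p)/c` (`c = ∫ w dHaar`) and `1` at
every other link is EXACT (`H_l = F_B/Z_B`), normalised link by link, local and squeezed.  Here the same
four facts for EVERY collection `B` of plaquettes of `(ℤ/L)^d`, EVERY `d`, that is RANKED for a
top-link assignment `t` (`t p` a link of `p`; `rank p < rank p'` whenever `t p` lies on another
`p' ∈ B`; `t` injective on `B` for the normalisation), with conditioners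
`q_b(U) = ∏_{p ∈ B, t p = b} w(U_p)/c`:

* §1 the fibres of `t` over a link are singletons or empty (`t` injective on `B`);
* §2 `∫ q_b(U[b ↦ v]) dHaar(v) = 1` for EVERY link `b` (Haar invariance at whichever of the four
  positions `b = t p` occupies in `p` — `integral_comp_plaquetteHolonomy_update_of_mem`);
* §3 `q_b` ignores every link off the plaquettes it closes; `min 1 (m/c) ≤ q_b ≤ max 1 (M/c)`;
* §4 EXACTNESS: for every duplicate-free list `l` of ALL links,
  `(∏_{b∈l} q_b(U))·A_l F_B(U)/Z_B = F_B(U)/Z_B` — by GEN-23's peeling identity `Z_B = c^{#B}`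
  (`integral_prod_weight_eq_pow_of_rank`) and `∏_b q_b = F_B/c^{#B}` (`prod_conditioner_eq`) — and
  `KL(F_B/Z_B ‖ H_l) = 0`;
The comb of `(ℤ/L)²` (`Scaling/TorusTopLinkComb`) is the instance that matters for the periodic
two-dimensional target: see the sequel `Scaling/AutoregressiveGaugeHeatBathComb`, where these four facts and
`PlaquetteTopLinkOrders` §4 make the one-plaquette heat-bath model along the comb an implementable exact
sampler of `(F_B/Z_B)·Haar^{⊗E}`, `B` = all plaquettes but one — the proposal law with `k = #Bᶜ = 1` in
`Scaling/AutoregressiveGaugeHeatBathTorusTauInt` (`τ_int ≤ M/m − 1/2` at every volume).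

No `def`, no `sorry`, nothing cited as a fact beyond the tree.
-/

noncomputable section

namespace Summit.Ventures.LatticeQCDFlow.Theory2.Autoregressive

open MeasureTheory Function Finset
open Literature.MathematicalPhysics.QuantumFieldTheory Literature.MathematicalPhysics.QuantumLattice
open Summit.Ventures.LatticeQCDFlow.Exactness

/-! ## §1 Fibres of an injective top-link assignment -/

section Fibres

variable {d L : ℕ}

/-- Over the top link of `p ∈ B` the fibre of an assignment injective on `B` is `{p}`. [ours] -/
theorem filter_top_eq_singleton_of_injOn (B : Finset (Plaquette d L)) (t : Plaquette d L → Edge d L)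
    (hinj : Set.InjOn t B) {p : Plaquette d L} (hp : p ∈ B) :
    B.filter (fun p' => t p' = t p) = {p} := by
  ext p'
  simp only [mem_filter, mem_singleton]
  constructor
  · rintro ⟨hp', h⟩; exact hinj hp' hp h
  · rintro rfl; exact ⟨hp, rfl⟩

/-- Over a link that tops no plaquette of `B` the fibre is empty. [ours] -/
theorem filter_top_eq_empty_of_forall_ne (B : Finset (Plaquette d L)) (t : Plaquette d L → Edge d L)
    {b : Edge d L} (hb : ∀ p ∈ B, t p ≠ b) : B.filter (fun p' => t p' = b) = ∅ := by
  ext p'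
  simp only [mem_filter, notMem_empty, iff_false, not_and]
  exact fun hp' h => hb p' hp' h

end Fibres

/-! ## §2 Normalisation in the generated link -/

section HaarLink

variable {d L : ℕ} [NeZero L] {G : Type*} [Group G] [TopologicalSpace G] [IsTopologicalGroup G]
  [CompactSpace G] [MeasurableSpace G] [BorelSpace G]

/-- **Redrawing any one link of a plaquette from Haar makes its holonomy Haar**: for each of the four
links `e` of `p = (x; i, j)` (`i ≠ j`, `L ≥ 2`), every `H : G → ℝ` and every configuration `U`,
`∫ H(U[e ↦ v]_p) dHaar(v) = ∫ H dHaar` (the link enters as `v·B`, `A·v·B`, `A·v⁻¹·B` or `A·v⁻¹`;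
left/right/inversion invariance of the Haar probability measure). [ours] -/
theorem integral_comp_plaquetteHolonomy_update_of_mem (hL : 2 ≤ L) (x : Site d L) {i j : Fin d}
    (hij : i ≠ j) {e : Edge d L}
    (he : e ∈ ({(x, i), (x.shift i, j), (x.shift j, i), (x, j)} : Finset (Edge d L)))
    (H : G → ℝ) (U : GaugeConfig d L G) :
    ∫ v, H (plaquetteHolonomy (update U e v) x i j) ∂(haarProbability G) =
      ∫ g, H g ∂(haarProbability G) := by
  simp only [Finset.mem_insert, Finset.mem_singleton] at he
  rcases he with rfl | rfl | rfl | rfl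
  · simp only [plaquetteHolonomy_update_first hL U x hij]
    exact integral_mul_right_eq_self H _
  · simp only [plaquetteHolonomy_update_second hL U x hij, mul_assoc]
    rw [integral_mul_right_eq_self (fun g => H (U (x, i) * g)) ((U (x.shift j, i))⁻¹ * (U (x, j))⁻¹)]
    exact integral_mul_left_eq_self H _
  · simp only [plaquetteHolonomy_update_third hL U x hij]
    rw [integral_inv_eq_self (fun g => H (U (x, i) * U (x.shift i, j) * g * (U (x, j))⁻¹))
      (haarProbability G)]
    simp only [mul_assoc]
    rw [integral_mul_right_eq_self (fun g => H (U (x, i) * (U (x.shift i, j) * g))) ((U (x, j))⁻¹),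
      integral_mul_left_eq_self (fun g => H (U (x, i) * g)) (U (x.shift i, j))]
    exact integral_mul_left_eq_self H _
  · simp only [plaquetteHolonomy_update_fourth hL U x hij]
    rw [integral_inv_eq_self (fun g => H (U (x, i) * U (x.shift i, j) * (U (x.shift j, i))⁻¹ * g))
      (haarProbability G)]
    exact integral_mul_left_eq_self H _

/-- **Every conditioner is normalised in its own link**: `∫ q_b(U[b ↦ v]) dHaar(v) = 1` for every link
`b` and every `U` (`L ≥ 2`, `∫ w ≠ 0`, `t` injective on `B`, `t p` a link of `p`): over a top link the
fibre is one plaquette whose holonomy becomes Haar, over any other link `q_b ≡ 1`. [ours] -/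
theorem rankedHeatBath_integral_update_eq_one (hL : 2 ≤ L) {w : G → ℝ}
    (hc : ∫ g, w g ∂(haarProbability G) ≠ 0) (B : Finset (Plaquette d L))
    (t : Plaquette d L → Edge d L) (hinj : Set.InjOn t B)
    (ht : ∀ p ∈ B, t p ∈ ({(p.1, p.2.1.1), (p.1.shift p.2.1.1, p.2.1.2),
        (p.1.shift p.2.1.2, p.2.1.1), (p.1, p.2.1.2)} : Finset (Edge d L)))
    (b : Edge d L) (U : GaugeConfig d L G) :
    ∫ v, ∏ p ∈ B.filter (fun p' => t p' = b),
        w (plaquetteHolonomy (update U b v) p.1 p.2.1.1 p.2.1.2) / (∫ g, w g ∂(haarProbability G))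
        ∂(haarProbability G) = 1 := by
  by_cases hb : ∃ p ∈ B, t p = b
  · obtain ⟨p, hp, rfl⟩ := hb
    rw [filter_top_eq_singleton_of_injOn B t hinj hp]
    simp only [prod_singleton]
    rw [integral_div, integral_comp_plaquetteHolonomy_update_of_mem hL p.1 (ne_of_lt p.2.2) (ht p hp) w U]
    exact div_self hc
  · push Not at hb
    rw [filter_top_eq_empty_of_forall_ne B t hb]
    simp

end HaarLink

/-! ## §3 Locality and squeezing -/

section Local

variable {d L : ℕ} {G : Type*} [Group G]

/-- **Locality**: `q_b` ignores the update of any link `e` that is not a link of a plaquette of `B` topped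
by `b`. [ours] -/
theorem rankedHeatBath_update_of_forall_ne {w : G → ℝ} (c : ℝ) (B : Finset (Plaquette d L))
    (t : Plaquette d L → Edge d L) (b e : Edge d L)
    (he : ∀ p ∈ B, t p = b → ((p.1, p.2.1.1) : Edge d L) ≠ e ∧
      ((p.1.shift p.2.1.1, p.2.1.2) : Edge d L) ≠ e ∧ ((p.1.shift p.2.1.2, p.2.1.1) : Edge d L) ≠ e ∧
        ((p.1, p.2.1.2) : Edge d L) ≠ e)
    (U : GaugeConfig d L G) (v : G) :
    ∏ p ∈ B.filter (fun p' => t p' = b), w (plaquetteHolonomy (update U e v) p.1 p.2.1.1 p.2.1.2) / c =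
      ∏ p ∈ B.filter (fun p' => t p' = b), w (plaquetteHolonomy U p.1 p.2.1.1 p.2.1.2) / c := by
  refine prod_congr rfl fun p hp => ?_
  rw [mem_filter] at hp
  obtain ⟨h1, h2, h3, h4⟩ := he p hp.1 hp.2
  rw [Summit.Ventures.LatticeQCDFlow.Theory2.Autoregressive.plaquetteHolonomy_update_of_ne U v h1 h2 h3 h4]

/-- **Squeezing**: with `mw ≤ w ≤ Mw`, `0 < c` and `t` injective on `B`, every `q_b(U)` lies in
`[min 1 (mw/c), max 1 (Mw/c)]` (the fibre over `b` is a singleton or empty). [ours] -/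
theorem rankedHeatBath_squeezed {w : G → ℝ} {mw Mw : ℝ} (hmw : ∀ g, mw ≤ w g) (hMw : ∀ g, w g ≤ Mw)
    {c : ℝ} (hc : 0 < c) (B : Finset (Plaquette d L)) (t : Plaquette d L → Edge d L)
    (hinj : Set.InjOn t B) (b : Edge d L) (U : GaugeConfig d L G) :
    min 1 (mw / c) ≤ ∏ p ∈ B.filter (fun p' => t p' = b),
        w (plaquetteHolonomy U p.1 p.2.1.1 p.2.1.2) / c ∧
      ∏ p ∈ B.filter (fun p' => t p' = b), w (plaquetteHolonomy U p.1 p.2.1.1 p.2.1.2) / c ≤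
        max 1 (Mw / c) := by
  by_cases hb : ∃ p ∈ B, t p = b
  · obtain ⟨p, hp, rfl⟩ := hb
    rw [filter_top_eq_singleton_of_injOn B t hinj hp, prod_singleton]
    exact ⟨(min_le_right _ _).trans (div_le_div_of_nonneg_right (hmw _) hc.le),
      (div_le_div_of_nonneg_right (hMw _) hc.le).trans (le_max_right _ _)⟩
  · push Not at hb
    rw [filter_top_eq_empty_of_forall_ne B t hb, prod_empty]
    exact ⟨min_le_left _ _, le_max_left _ _⟩

end Local

/-! ## §4 Exactness on every ranked collection -/

section Exact

variable {d L : ℕ} [NeZero L] {G : Type*} [Group G] [TopologicalSpace G] [IsTopologicalGroup G]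
  [CompactSpace G] [SecondCountableTopology G] [MeasurableSpace G] [BorelSpace G]

/-- **EXACTNESS: on a ranked collection the heat-bath autoregressive hybrid IS the block law.**  `L ≥ 2`;
`w` continuous with `0 < m ≤ w ≤ M`; `t p` a link of `p` for `p ∈ B` and `rank p < rank p'` whenever
`t p` lies on another `p' ∈ B`.  Then for every duplicate-free list `l` of ALL links and every `U`:
`(∏_{b∈l} q_b(U)) · A_l F_B(U)/Z_B = F_B(U)/Z_B`, where `F_B = ∏_{p∈B} w(U_p)`, `Z_B = ∫ F_B dHaar^{⊗E}`,
`A_l F_B = Z_B` (`q_b(U) = ∏_{p∈B, t p = b} w(U_p)/c`, `c = ∫ w dHaar`). [ours] -/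
theorem ranked_arHybrid_eq_target (hL : 2 ≤ L) {w : G → ℝ} (hw : Continuous w) {m M : ℝ}
    (hm0 : 0 < m) (hm : ∀ g, m ≤ w g) (hM : ∀ g, w g ≤ M) (B : Finset (Plaquette d L))
    (t : Plaquette d L → Edge d L)
    (ht : ∀ p ∈ B, t p ∈ ({(p.1, p.2.1.1), (p.1.shift p.2.1.1, p.2.1.2),
        (p.1.shift p.2.1.2, p.2.1.1), (p.1, p.2.1.2)} : Finset (Edge d L)))
    (rank : Plaquette d L → ℕ)
    (hrank : ∀ p ∈ B, ∀ p' ∈ B, p ≠ p' → t p ∈ ({(p'.1, p'.2.1.1), (p'.1.shift p'.2.1.1, p'.2.1.2),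
        (p'.1.shift p'.2.1.2, p'.2.1.1), (p'.1, p'.2.1.2)} : Finset (Edge d L)) → rank p < rank p')
    (l : List (Edge d L)) (hl : l.Nodup) (hall : ∀ e : Edge d L, e ∈ l) (U : GaugeConfig d L G) :
    (l.map fun b => ∏ p ∈ B.filter (fun p' => t p' = b),
        w (plaquetteHolonomy U p.1 p.2.1.1 p.2.1.2) / (∫ g, w g ∂(haarProbability G))).prod *
        coordAvg (haarProbability G) l.toFinset
          (fun V : GaugeConfig d L G => ∏ p ∈ B, w (plaquetteHolonomy V p.1 p.2.1.1 p.2.1.2)) U /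
        (∫ V, ∏ p ∈ B, w (plaquetteHolonomy V p.1 p.2.1.1 p.2.1.2)
          ∂(Measure.pi fun _ : Edge d L => haarProbability G)) =
      (∏ p ∈ B, w (plaquetteHolonomy U p.1 p.2.1.1 p.2.1.2)) /
        (∫ V, ∏ p ∈ B, w (plaquetteHolonomy V p.1 p.2.1.1 p.2.1.2)
          ∂(Measure.pi fun _ : Edge d L => haarProbability G)) := by
  have hw0 : ∀ g, 0 < w g := fun g => hm0.trans_le (hm g)
  have hc : 0 < ∫ g, w g ∂(haarProbability G) := haarProbability_integral_pos_of_continuous_pos hw hw0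
  have hZ := integral_prod_weight_eq_pow_of_rank (G := G) hL hw hm0 hm hM B t ht rank hrank
  have hto : l.toFinset = Finset.univ := eq_univ_iff_forall.mpr fun e => List.mem_toFinset.mpr (hall e)
  rw [← List.prod_toFinset _ hl, hto, prod_conditioner_eq w _ B t U, coordAvg_univ, hZ]
  field_simp

/-- **`KL(F_B/Z_B ‖ H_l) = 0`** on a ranked collection, under the hypotheses of
`ranked_arHybrid_eq_target`. [ours] -/
theorem ranked_kl_arHybrid_eq_zero (hL : 2 ≤ L) {w : G → ℝ} (hw : Continuous w) {m M : ℝ}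
    (hm0 : 0 < m) (hm : ∀ g, m ≤ w g) (hM : ∀ g, w g ≤ M) (B : Finset (Plaquette d L))
    (t : Plaquette d L → Edge d L)
    (ht : ∀ p ∈ B, t p ∈ ({(p.1, p.2.1.1), (p.1.shift p.2.1.1, p.2.1.2),
        (p.1.shift p.2.1.2, p.2.1.1), (p.1, p.2.1.2)} : Finset (Edge d L)))
    (rank : Plaquette d L → ℕ)
    (hrank : ∀ p ∈ B, ∀ p' ∈ B, p ≠ p' → t p ∈ ({(p'.1, p'.2.1.1), (p'.1.shift p'.2.1.1, p'.2.1.2),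
        (p'.1.shift p'.2.1.2, p'.2.1.1), (p'.1, p'.2.1.2)} : Finset (Edge d L)) → rank p < rank p')
    (l : List (Edge d L)) (hl : l.Nodup) (hall : ∀ e : Edge d L, e ∈ l) :
    ∫ U, (∏ p ∈ B, w (plaquetteHolonomy U p.1 p.2.1.1 p.2.1.2)) /
        (∫ V, ∏ p ∈ B, w (plaquetteHolonomy V p.1 p.2.1.1 p.2.1.2)
          ∂(Measure.pi fun _ : Edge d L => haarProbability G)) *
      Real.log (((∏ p ∈ B, w (plaquetteHolonomy U p.1 p.2.1.1 p.2.1.2)) /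
        (∫ V, ∏ p ∈ B, w (plaquetteHolonomy V p.1 p.2.1.1 p.2.1.2)
          ∂(Measure.pi fun _ : Edge d L => haarProbability G))) /
        ((l.map fun b => ∏ p ∈ B.filter (fun p' => t p' = b),
            w (plaquetteHolonomy U p.1 p.2.1.1 p.2.1.2) / (∫ g, w g ∂(haarProbability G))).prod *
          coordAvg (haarProbability G) l.toFinset
            (fun V : GaugeConfig d L G => ∏ p ∈ B, w (plaquetteHolonomy V p.1 p.2.1.1 p.2.1.2)) U /
          (∫ V, ∏ p ∈ B, w (plaquetteHolonomy V p.1 p.2.1.1 p.2.1.2)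
            ∂(Measure.pi fun _ : Edge d L => haarProbability G))))
      ∂(Measure.pi fun _ : Edge d L => haarProbability G) = 0 := by
  refine integral_eq_zero_of_ae (ae_of_all _ fun U => ?_)
  have h := ranked_arHybrid_eq_target (G := G) hL hw hm0 hm hM B t ht rank hrank l hl hall U
  rw [Pi.zero_apply]
  beta_reduce
  rw [h]
  have hw0 : ∀ g, 0 < w g := fun g => hm0.trans_le (hm g)
  have hc : 0 < ∫ g, w g ∂(haarProbability G) := haarProbability_integral_pos_of_continuous_pos hw hw0
  have hZ := integral_prod_weight_eq_pow_of_rank (G := G) hL hw hm0 hm hM B t ht rank hrank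
  have hF : 0 < ∏ p ∈ B, w (plaquetteHolonomy U p.1 p.2.1.1 p.2.1.2) := prod_pos fun p _ => hw0 _
  have hZpos : 0 < ∫ V, ∏ p ∈ B, w (plaquetteHolonomy V p.1 p.2.1.1 p.2.1.2)
      ∂(Measure.pi fun _ : Edge d L => haarProbability G) := by
    rw [hZ]; exact pow_pos hc _
  rw [div_self (div_pos hF hZpos).ne', Real.log_one, mul_zero]

end Exact

end Summit.Ventures.LatticeQCDFlow.Theory2.Autoregressive

end
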